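import Summits.BirchSwinnertonDyer.Rank1Residual.P2.PrintCf2SplitBadTwoInstTwoCore
import Summits.BirchSwinnertonDyer.Rank1Residual.P2.PrintCf2SplitBadTwoLocalUntwist
import Summits.BirchSwinnertonDyer.Rank1Residual.P2.PrintCf2SplitBadTwoSeamModLevel
import Literature.NumberTheory.GaloisRepresentations.LubinTateComparisonTraceTransportRelTwo
import HarnessLib

set_option autoImplicit false

/-!
# R219-INST₂-CORE, the (δ)-core on the ℂ_F side: the reading value `V_β(z) = ½(Lg_β z − Lg_β z′) + c_β` ON THE NOSE at every
# `Ĝ_m`-reflecting pair `z′ = −2 − z` (principal normalisation `g̃_β`, the plog split, a `z`-UNIFORM reading witness)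

Cell `bsd-print-cf2`, discharge-interface typer `bsd-print-cf2-ty2` g46 (literature-prover seat; Summits-side helpers in the
typer's directory `Rank1Residual/P2/`, Theses-free, no item): port **P62 (part 3a: PART M §C)** of STUB-PLAN
`stub_heegnerIndexLowerAtTwo` v8.1 (crux `PrintCf2.SplitBadTwoLowerHalfOfFacts`, stmt-BirchSwinnertonDyer-27851; `CRITIC-ROWS-g46.md` row
132 = **R227 «THE SEAM MODULO LEVEL n»**; sketch k1-g43 `c394c15f3c926eba` PART M §C (ll. 1485–1503, 1558–1747), §D (ll. 1749–1864),
§E (ll. 1866–2035) — §D/§E in the sequel `PrintCf2SplitBadTwoDeltaRead.lean` —, re-targeted from the sketch's verbatim parts onto the tree's ports P47/P48/P50/P52/P53/P58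
(`ReadTwoCut`, `ReflectionPrimitive`, `ShiftLift`, `LocalUntwist`, `InstTwoCore`) and onto part 1 `SeamModLevel` / part 2
`Literature.NumberTheory.GaloisRepresentations.evS_map_reflE`; the sketch's extra binder `hθlt : ‖x‖ < 1 → ‖θ x‖ < 1` is
REPLACED by the frame's `hθc : Continuous θ` through the critic's certificate `critic_g46_hthetalt.lean`
(`norm_map_lt_one_of_continuous`, §0); the sketch's hypothesis `hex : LocalUntwistExists …` of E7 is DISCHARGED by the tree's
theorem `LocalUntwist.localUntwistExists` (P52)).  HONEST FRAMING: road-B′ construction plumbing below the receptacle (weight 0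
in the critic's Heegner-weight test); nothing here proves BSD, the crux, the stub or HARDEST (a)/(b); no named fact, no `sorry`.
The `def`s of this file (`gC`, `baseUnit`, `gN`, `thetaPt`, `Lg`, `readingValue`) are data (series, points, tables), not propositions.

* §0 `norm_map_lt_one_of_continuous` (critic g46): a continuous ring hom of normed division rings maps the open unit ball into
  the open unit ball; `norm_one_sub_lt_of_mul_eq` (principal units: `q·r = x`, `r, x` principal ⟹ `q` principal).
* §C the (δ)-CORE on the ℂ_F side: `gC` (`ḡ_β`), `baseUnit`, `gN` (`g̃_β = ḡ_β(0)⁻¹ḡ_β`), C3 `evS_reflQuotC_mul_evS_gC`, `thetaPt`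
  (`ϑ̄(z)`), `coe_thetaPt_reflect`, C4/C4′ `reflQuot_thetaBar_mul_gC` / `_gN`, `Lg` (the log table on the principal normalisation),
  `norm_one_sub_theta_gN_lt`, C5 ★★ `plog_reflQuot_thetaBar_eq_sub`, C6 ★ `inst₂_core_uniform` (a `z`-UNIFORM reading witness),
  `readingValue`, C8 ★★★ `readingValue_eq_half_sub`.
* §D/§E ((δ) assembled: ★★ `delta_read₂`, `delta_charSum`; the typed remainder of (γ′)) are in the sequel
  `PrintCf2SplitBadTwoDeltaRead.lean`.

References: stub-critic `CRITIC-ROWS-g46.md` row 132, `critic_g46_hthetalt.lean`; [deShalit1987] I.3.2 (5), (7) (p. 17), I.3.3 (7)–(8),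
I §2.2 Theorem (p. 13), (p. 21–22); [Lang1990CyclotomicFields] Ch. 7, CW 1–2 (p. 130).
-/

noncomputable section

open scoped PowerSeries.WithPiTopology

namespace Summit.BirchSwinnertonDyer.Rank1Residual.P2.DeltaRead

/-! ### §0  Two generic lemmas -/

/-- **A continuous ring hom of normed division rings maps the open unit ball into the open unit ball** (`x^n → 0` ⇒
`θ(x)^n = θ(x^n) → 0`, impossible if `1 ≤ ‖θ x‖`).  The stub-critic's certificate `critic_g46_hthetalt.lean` (g46): it
discharges the sketch's binder `hθlt` from the frame's continuity binder `hθc`. -/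
theorem norm_map_lt_one_of_continuous {K L : Type*} [NormedDivisionRing K] [NormedDivisionRing L]
    (θ : K →+* L) (hθc : Continuous θ) {x : K} (hx : ‖x‖ < 1) : ‖θ x‖ < 1 := by
  have h1 : Filter.Tendsto (fun n : ℕ => x ^ n) Filter.atTop (nhds 0) :=
    tendsto_pow_atTop_nhds_zero_of_norm_lt_one hx
  have h2 : Filter.Tendsto (fun n : ℕ => θ x ^ n) Filter.atTop (nhds 0) := by
    have h := ((hθc.tendsto 0).comp h1)
    simp only [map_zero] at h
    refine h.congr ?_
    intro n
    simp [map_pow]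
  exact tendsto_pow_atTop_nhds_zero_iff_norm_lt_one.mp h2

/-- C0. Principal units: `q·r = x` with `r, x` principal ⟹ `q` principal. -/
theorem norm_one_sub_lt_of_mul_eq {𝕜 : Type*} [NormedField 𝕜] [IsUltrametricDist 𝕜] {x q r : 𝕜}
    (hr : ‖1 - r‖ < 1) (hx : ‖1 - x‖ < 1) (h : q * r = x) : ‖1 - q‖ < 1 := by
  have hr1 := Literature.NumberTheory.Transcendental.IwasawaLog.norm_eq_one_of_norm_one_sub_lt hr
  have hr0 : r ≠ 0 := fun h0 => by rw [h0, norm_zero] at hr1; exact zero_ne_one hr1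
  have hq : q = x * r⁻¹ := by rw [← h, mul_inv_cancel_right₀ hr0]
  rw [hq]
  exact Literature.NumberTheory.Transcendental.IwasawaLog.norm_one_sub_mul_lt hx
    (Literature.NumberTheory.Transcendental.IwasawaLog.norm_one_sub_inv_lt hr)

section Witness

open ValuativeRel IsLocalRing Field
open Literature.NumberTheory.Transcendental
open Literature.NumberTheory.GaloisRepresentations Literature.NumberTheory.GaloisRepresentations.IsNonarchimedeanLocalField
  Literature.NumberTheory.GaloisRepresentations.LubinTate Literature.NumberTheory.PAdicHodge
  Literature.NumberTheory.EllipticCurves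
open InstTwoCore (thetaBar constantCoeff_thetaBar reflQuotC reflQuotN gaugeUnit gaugeConst)
open SeamModLevel

variable {F : Type} [Field F] [ValuativeRel F] [TopologicalSpace F] [IsNonarchimedeanLocalField F]

attribute [local instance] ltNormUniformSpace ltNormIsUniformAddGroup rk1 nF nE fintypeResidueField

variable (hq : residueFieldCard F = 2) (h2 : (valuation F).IsUniformizer (((2 : ℕ) : 𝒪[F]) : F)) (u : 𝒪[F]ˣ)
variable (E : IntermediateField F (AlgebraicClosure F)) [FiniteDimensional F E] [Normal F E] [IsGalois F E]
  (hE : E ≤ maxUnramified F) {σ₀ : absoluteGaloisGroup F} (hσ₀ : IsAbsArithFrob σ₀)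
variable {ε : (maxUnramifiedCompletion F)ˣ}
  (hε : maxUnramifiedCompletion.galAut F σ₀ (ε : maxUnramifiedCompletion F) =
    algebraMap 𝒪[F] (maxUnramifiedCompletion F) (u : 𝒪[F]) * (ε : maxUnramifiedCompletion F))
variable (θ : CompletedAlgClosure F →+* ℂ_[2]) (hθc : Continuous θ)
  (hθ1 : ∀ z : CBall F, ‖θ (z : CompletedAlgClosure F)‖ ≤ 1)

/-- C2. `ḡ_β` — the relative Coleman series `g_β` (`ReflectionPrimitive.gUnit`, P48) read in `𝒪_ℂ⟦X⟧`. -/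
def gC (β : RelNormCoherentUnits (isUniformizer_unit_mul h2 u) E) : PowerSeries (CBall F) :=
  (ReflectionPrimitive.gUnit (isUniformizer_unit_mul h2 u) E hq hE hσ₀ β : PowerSeries (unitBall E)).map
    (unitBallToCBall E)

/-- `ḡ_β` is a unit of `𝒪_ℂ⟦X⟧`. -/
theorem isUnit_gC (β : RelNormCoherentUnits (isUniformizer_unit_mul h2 u) E) : IsUnit (gC hq h2 u E hE hσ₀ β) :=
  (ReflectionPrimitive.gUnit (isUniformizer_unit_mul h2 u) E hq hE hσ₀ β).isUnit.map
    (PowerSeries.map (unitBallToCBall E))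

/-- `ḡ_β(0)` is a unit of `𝒪_ℂ`. -/
theorem isUnit_constantCoeff_gC (β : RelNormCoherentUnits (isUniformizer_unit_mul h2 u) E) :
    IsUnit (PowerSeries.constantCoeff (gC hq h2 u E hE hσ₀ β)) :=
  PowerSeries.isUnit_iff_constantCoeff.mp (isUnit_gC hq h2 u E hE hσ₀ β)

/-- `g_β(0)` read in `𝒪_ℂ`, as a unit (it is NOT a principal unit in general — log-branch remark (β′)). -/
def baseUnit (β : RelNormCoherentUnits (isUniformizer_unit_mul h2 u) E) : (CBall F)ˣ :=
  (isUnit_constantCoeff_gC hq h2 u E hE hσ₀ β).unit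

/-- Unfolding lemma for `baseUnit`. -/
theorem coe_baseUnit (β : RelNormCoherentUnits (isUniformizer_unit_mul h2 u) E) :
    (baseUnit hq h2 u E hE hσ₀ β : CBall F) = PowerSeries.constantCoeff (gC hq h2 u E hE hσ₀ β) := rfl

/-- C2′. `g̃_β := g_β(0)⁻¹ · ḡ_β` — the PRINCIPAL normalisation (`g̃_β(0) = 1`). -/
def gN (β : RelNormCoherentUnits (isUniformizer_unit_mul h2 u) E) : PowerSeries (CBall F) :=
  PowerSeries.C ((↑(baseUnit hq h2 u E hE hσ₀ β)⁻¹ : CBall F)) * gC hq h2 u E hE hσ₀ β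

/-- `g̃_β(0) = 1`. -/
theorem constantCoeff_gN (β : RelNormCoherentUnits (isUniformizer_unit_mul h2 u) E) :
    PowerSeries.constantCoeff (gN hq h2 u E hE hσ₀ β) = 1 :=
  InstTwoCore.constantCoeff_C_inv_mul (baseUnit hq h2 u E hE hσ₀ β) (coe_baseUnit hq h2 u E hE hσ₀ β).symm

include hq in
/-- C3 ★ `Q̄_β(y) · ḡ_β(y') = ḡ_β(y)` for `y' = −π' − y` in `𝔪_ℂ` (`π' = u·2`): `InstTwoCore.reflQuot_mul_reflE` (`Q_β · τ_E g_β = g_β`) mapped to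
`𝒪_ℂ⟦X⟧`, evaluated, and C1. -/
theorem evS_reflQuotC_mul_evS_gC (β : RelNormCoherentUnits (isUniformizer_unit_mul h2 u) E)
    (y y' : (maxNilIdealC F).toIdeal)
    (hy' : ((y' : CBall F) : CompletedAlgClosure F) =
      -algebraMap F (CompletedAlgClosure F) ((((u : 𝒪[F]) * ((2 : ℕ) : 𝒪[F]) : 𝒪[F]) : F)) -
        ((y : CBall F) : CompletedAlgClosure F)) :
    evS (maxNilIdealC F) y (reflQuotC hq h2 u E hE hσ₀ β) * evS (maxNilIdealC F) y' (gC hq h2 u E hE hσ₀ β) =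
      evS (maxNilIdealC F) y (gC hq h2 u E hE hσ₀ β) := by
  have h := congrArg (PowerSeries.map (unitBallToCBall E)) (InstTwoCore.reflQuot_mul_reflE hq h2 u E hE hσ₀ β)
  rw [map_mul] at h
  have hev := congrArg (evS (maxNilIdealC F) y) h
  rw [map_mul, evS_map_reflE hq E (isUniformizer_unit_mul h2 u) _ y y' hy'] at hev
  exact hev

/-- The `ϑ̄`-point of `z`: `ϑ̄(z) ∈ 𝔪_ℂ`. -/
def thetaPt (z : (maxNilIdealC F).toIdeal) : (maxNilIdealC F).toIdeal :=
  ⟨evS (maxNilIdealC F) z (thetaBar h2 u hσ₀ hε),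
    evS_mem_of_constantCoeff_eq_zero _ z (constantCoeff_thetaBar h2 u hσ₀ hε)⟩

/-- `thetaPt` is the tree's `evalPt₁` of the comparison series (`evalPt₁_compSeriesC_eq_mk_evS`). -/
theorem thetaPt_eq_evalPt₁ (z : (maxNilIdealC F).toIdeal) :
    thetaPt h2 u hσ₀ hε z =
      evalPt₁ (maxNilIdealC F) (compSeriesC h2 hσ₀ u hε) (constantCoeff_compSeriesC h2 hσ₀ u hε) z :=
  (evalPt₁_compSeriesC_eq_mk_evS hσ₀ u hε h2 z).symm

include hq in
/-- `ϑ̄` intertwines the two reflections: `ϑ̄(z') = −π' − ϑ̄(z)` for `z' = −2 − z` (tree `coe_evalPt₁_compSeriesC_reflect`). -/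
theorem coe_thetaPt_reflect (z z' : (maxNilIdealC F).toIdeal)
    (hz' : ((z' : CBall F) : CompletedAlgClosure F) = -2 - ((z : CBall F) : CompletedAlgClosure F)) :
    ((thetaPt h2 u hσ₀ hε z' : CBall F) : CompletedAlgClosure F) =
      -algebraMap F (CompletedAlgClosure F) ((((u : 𝒪[F]) * ((2 : ℕ) : 𝒪[F]) : 𝒪[F]) : F)) -
        ((thetaPt h2 u hσ₀ hε z : CBall F) : CompletedAlgClosure F) := by
  rw [thetaPt_eq_evalPt₁, thetaPt_eq_evalPt₁]
  exact coe_evalPt₁_compSeriesC_reflect hq h2 hσ₀ u hε z z' hz'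

/-- Evaluation commutes with substitution of `ϑ̄`: `(G ∘ ϑ̄)(z) = G(ϑ̄ z)` (tree `evS_subst`). -/
theorem evS_subst_thetaBar (z : (maxNilIdealC F).toIdeal) (G : PowerSeries (CBall F)) :
    evS (maxNilIdealC F) z (PowerSeries.subst (thetaBar h2 u hσ₀ hε) G) =
      evS (maxNilIdealC F) (thetaPt h2 u hσ₀ hε z) G :=
  evS_subst (maxNilIdealC F) z (constantCoeff_thetaBar h2 u hσ₀ hε) G

include hq in
/-- C4 ★ `Q̄_β(ϑ̄ z) · ḡ_β(ϑ̄ z') = ḡ_β(ϑ̄ z)` for `z' = −2 − z`. -/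
theorem reflQuot_thetaBar_mul_gC (β : RelNormCoherentUnits (isUniformizer_unit_mul h2 u) E)
    (z z' : (maxNilIdealC F).toIdeal)
    (hz' : ((z' : CBall F) : CompletedAlgClosure F) = -2 - ((z : CBall F) : CompletedAlgClosure F)) :
    evS (maxNilIdealC F) z (PowerSeries.subst (thetaBar h2 u hσ₀ hε) (reflQuotC hq h2 u E hE hσ₀ β)) *
        evS (maxNilIdealC F) z' (PowerSeries.subst (thetaBar h2 u hσ₀ hε) (gC hq h2 u E hE hσ₀ β)) =
      evS (maxNilIdealC F) z (PowerSeries.subst (thetaBar h2 u hσ₀ hε) (gC hq h2 u E hE hσ₀ β)) := by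
  rw [evS_subst_thetaBar, evS_subst_thetaBar, evS_subst_thetaBar]
  exact evS_reflQuotC_mul_evS_gC hq h2 u E hE hσ₀ β _ _ (coe_thetaPt_reflect hq h2 u hσ₀ hε z z' hz')

include hq in
/-- C4′ ★ normalised: `Q̄_β(ϑ̄ z) · g̃_β(ϑ̄ z') = g̃_β(ϑ̄ z)` (the quotient is gauge-invariant, k1-g41 (β′)). -/
theorem reflQuot_thetaBar_mul_gN (β : RelNormCoherentUnits (isUniformizer_unit_mul h2 u) E)
    (z z' : (maxNilIdealC F).toIdeal)
    (hz' : ((z' : CBall F) : CompletedAlgClosure F) = -2 - ((z : CBall F) : CompletedAlgClosure F)) :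
    evS (maxNilIdealC F) z (PowerSeries.subst (thetaBar h2 u hσ₀ hε) (reflQuotC hq h2 u E hE hσ₀ β)) *
        evS (maxNilIdealC F) z' (PowerSeries.subst (thetaBar h2 u hσ₀ hε) (gN hq h2 u E hE hσ₀ β)) =
      evS (maxNilIdealC F) z (PowerSeries.subst (thetaBar h2 u hσ₀ hε) (gN hq h2 u E hE hσ₀ β)) := by
  have h := reflQuot_thetaBar_mul_gC hq h2 u E hE hσ₀ hε β z z' hz'
  rw [evS_subst_thetaBar, evS_subst_thetaBar, evS_subst_thetaBar] at h ⊢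
  simp only [gN, map_mul, evS_C]
  rw [mul_left_comm, h]

/-- `Lg_β w := plog θ(g̃_β(ϑ̄ w))` — the `Lg`-table of `read₂_of_refl_cut` ON THE PRINCIPAL NORMALISATION. -/
def Lg (β : RelNormCoherentUnits (isUniformizer_unit_mul h2 u) E) (w : (maxNilIdealC F).toIdeal) : ℂ_[2] :=
  PadicExp.plog (θ ((evS (maxNilIdealC F) w
    (PowerSeries.subst (thetaBar h2 u hσ₀ hε) (gN hq h2 u E hE hσ₀ β)) : CBall F) : CompletedAlgClosure F))

include hθc in
/-- `θ(g̃_β(ϑ̄ w))` is a principal unit of `ℂ₂` (`g̃_β(0) = 1`, `ReadTwoCut.norm_one_sub_evS_lt_one`, and the continuity of `θ`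
through `norm_map_lt_one_of_continuous` — the critic's discharge of the sketch's extra binder `hθlt`). -/
theorem norm_one_sub_theta_gN_lt (β : RelNormCoherentUnits (isUniformizer_unit_mul h2 u) E)
    (w : (maxNilIdealC F).toIdeal) :
    ‖1 - θ ((evS (maxNilIdealC F) w
      (PowerSeries.subst (thetaBar h2 u hσ₀ hε) (gN hq h2 u E hE hσ₀ β)) : CBall F) : CompletedAlgClosure F)‖ < 1 := by
  rw [evS_subst_thetaBar, ← map_one θ, ← map_sub]
  refine norm_map_lt_one_of_continuous θ hθc ?_
  have h := ReadTwoCut.norm_one_sub_evS_lt_one (gN hq h2 u E hE hσ₀ β) (constantCoeff_gN hq h2 u E hE hσ₀ β)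
    (thetaPt h2 u hσ₀ hε w)
  simpa using h

include hq hθc in
/-- C5 ★★ **THE PLOG SPLIT AT A REFLECTING PAIR**: `plog θ(Q̄_β(ϑ̄ z)) = Lg_β z − Lg_β z'` (`z' = −2 − z`). -/
theorem plog_reflQuot_thetaBar_eq_sub (β : RelNormCoherentUnits (isUniformizer_unit_mul h2 u) E)
    (z z' : (maxNilIdealC F).toIdeal)
    (hz' : ((z' : CBall F) : CompletedAlgClosure F) = -2 - ((z : CBall F) : CompletedAlgClosure F)) :
    PadicExp.plog (θ ((evS (maxNilIdealC F) z
        (PowerSeries.subst (thetaBar h2 u hσ₀ hε) (reflQuotC hq h2 u E hE hσ₀ β)) : CBall F) :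
          CompletedAlgClosure F)) =
      Lg hq h2 u E hE hσ₀ hε θ β z - Lg hq h2 u E hE hσ₀ hε θ β z' := by
  have hmul := congrArg (fun s : CBall F => θ (s : CompletedAlgClosure F))
    (reflQuot_thetaBar_mul_gN hq h2 u E hE hσ₀ hε β z z' hz')
  simp only [Subring.coe_mul, map_mul] at hmul
  have hr := norm_one_sub_theta_gN_lt hq h2 u E hE hσ₀ hε θ hθc β z'
  have hx := norm_one_sub_theta_gN_lt hq h2 u E hE hσ₀ hε θ hθc β z
  exact ReadTwoCut.plog_eq_sub_of_mul_eq (norm_one_sub_lt_of_mul_eq hr hx hmul) hr hmul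

include hθc hθ1 in
/-- C6 ★ **z-UNIFORM WITNESS (strongest provable form of (α))**: ONE pair `(L, y)` — hence ONE reading series
`(L∘y)∘ϑ̄ ∈ 𝒪_ℂ⟦S⟧` — whose `θ`-value at EVERY `z₀ ∈ 𝔪_ℂ` is `½·plog θ(P_β(ϑ̄ z₀))`.  (k1-g41/J10 chose `L, y`
after `z₀`; (δ) needs one series for the whole torsion packet.) -/
theorem inst₂_core_uniform (β : RelNormCoherentUnits (isUniformizer_unit_mul h2 u) E) :
    ∃ L y : PowerSeries (CBall F), PowerSeries.constantCoeff y = 0 ∧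
      reflQuotN hq h2 u E hE hσ₀ β = 1 + PowerSeries.C (2 : CBall F) * y ∧
      θ ((PowerSeries.coeff 0 L : CBall F) : CompletedAlgClosure F) = 0 ∧
      ∀ z₀ : (maxNilIdealC F).toIdeal,
        ∑' m : ℕ, PowerSeries.coeff m (PowerSeries.map (θ.comp (CBall F).subtype)
            (PowerSeries.subst (thetaBar h2 u hσ₀ hε) (PowerSeries.subst y L))) *
            (θ ((z₀ : CBall F) : CompletedAlgClosure F)) ^ m =
          (2 : ℂ_[2])⁻¹ * PadicExp.plog
            (θ ((evS (maxNilIdealC F) z₀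
              (PowerSeries.subst (thetaBar h2 u hσ₀ hε) (reflQuotN hq h2 u E hE hσ₀ β)) : CBall F) :
                CompletedAlgClosure F)) := by
  obtain ⟨y, hy0, hPy⟩ := ShiftLift.exists_eq_one_add_C_mul (2 : CBall F) (reflQuotN hq h2 u E hE hσ₀ β)
    (InstTwoCore.constantCoeff_reflQuotN hq h2 u E hE hσ₀ β) (InstTwoCore.two_dvd_coeff_succ_reflQuotN hq h2 u E hE hσ₀ β)
  obtain ⟨L, hL0, hL⟩ := ShiftLift.exists_Lam2_lift_map (norm_two_lt_one_C h2) θ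
  refine ⟨L, y, hy0, hPy, hL0, fun z₀ => ?_⟩
  rw [ReadTwoCut.tsum_coeff_map_subst_mul_pow_eq θ hθc (PowerSeries.subst y L) (thetaBar h2 u hσ₀ hε)
      (constantCoeff_thetaBar h2 u hσ₀ hε) z₀,
    evS_subst (maxNilIdealC F) z₀ (constantCoeff_thetaBar h2 u hσ₀ hε)]
  exact (ReadTwoCut.read_value_eq_tsum_lamTerm θ hθc L y hy0 hL0 hL (thetaPt h2 u hσ₀ hε z₀)).trans
    (ReadTwoCut.lambda_value_refl_evS θ hθ1 hPy (thetaPt h2 u hσ₀ hε z₀))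

/-- C7. `V_β(z) := ½·plog θ(P_β(ϑ̄ z))` — THE VALUE TABLE of the (uniform) reading witness. -/
def readingValue (β : RelNormCoherentUnits (isUniformizer_unit_mul h2 u) E) (z : (maxNilIdealC F).toIdeal) : ℂ_[2] :=
  (2 : ℂ_[2])⁻¹ * PadicExp.plog (θ ((evS (maxNilIdealC F) z
    (PowerSeries.subst (thetaBar h2 u hσ₀ hε) (reflQuotN hq h2 u E hE hσ₀ β)) : CBall F) : CompletedAlgClosure F))

include hq hθc hθ1 in
/-- C8 ★★★ **(δ)'s `hS1` AT THE WITNESS, ON THE NOSE**: `V_β(z) = ½·(Lg_β z − Lg_β z') + c_β` at every reflecting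
pair `z' = −2 − z` — the (β)-key `InstTwoCore.half_plog_reflQuotN_eq` + C5. -/
theorem readingValue_eq_half_sub (β : RelNormCoherentUnits (isUniformizer_unit_mul h2 u) E)
    (z z' : (maxNilIdealC F).toIdeal)
    (hz' : ((z' : CBall F) : CompletedAlgClosure F) = -2 - ((z : CBall F) : CompletedAlgClosure F)) :
    readingValue hq h2 u E hE hσ₀ hε θ β z =
      2⁻¹ * (Lg hq h2 u E hE hσ₀ hε θ β z - Lg hq h2 u E hE hσ₀ hε θ β z') + gaugeConst hq h2 u E hE hσ₀ θ β := by
  rw [readingValue, InstTwoCore.half_plog_reflQuotN_eq hq h2 u E hE hσ₀ hε θ hθ1 β z,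
    plog_reflQuot_thetaBar_eq_sub hq h2 u E hE hσ₀ hε θ hθc β z z' hz']

end Witness

end Summit.BirchSwinnertonDyer.Rank1Residual.P2.DeltaRead

end
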